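import Summits.BirchSwinnertonDyer.BirchSwinnertonDyer.Theorems.Rank1ResidualJetConjActPlaceUnramified
import Literature.NumberTheory.EllipticCurves.HeegnerPointsKolyvaginInvisibleLocalProofs
import HarnessLib

/-!
# Route `GenusKolyvaginAtTwo`, crux L_T `PowDvdShaCardAtTwoRT` (stmt-BirchSwinnertonDyer-23242), LINE 18: the NON-PHANTOM hypothesis
# (NPh_M) discharges Q5R's separation hypothesis `hres` at EVERY level `2^M`, for families Selmer off deep Kolyvagin places

LEAD seat `bsd-line-gk2-p1` g17 (cell `bsd-f1-sign2`), `--supports 23242 --as helper`.  THEOREMS ONLY; no `sorry`; standard axioms.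
BSD is NOT proved by any of this; neither is the crux nor stub L.

WHY (memo `Cruxes/PowDvdShaCardAtTwoRT/Lines/plus-descent-lead-g17.md` §2).  Every Čebotarev application of the line (Q5R
`EquivariantChebotarevAtTwoR`, gk2-p2's pair Čebotarev theorems, the swap oracles) carries the separation hypothesis
`hres : ∀ a, (∀ ρ ∈ Γ_{K(E[2^M])}, [Σ aᵢ csᵢ, ρ] = 0) → Σ aᵢ csᵢ = 0` — «no non-zero element of the span dies on `Γ_{K(E[2^M])}`»
(the Lawson–Wuthrich phantom `H¹(K(E[2^M])/K, E[2^M]) ≅ ℤ/2` is the obstruction).  A class dying on `Γ_{K(E[2^M])}` is locally ZERO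
at every place of `K` over a Zhang–Kolyvagin prime of index `≥ M` (the place splits completely in `K(E[2^M])`:
`JET.GlobalDuality.galoisRep_toLocal_apply_eq_self`), so for a family of classes each satisfying the Selmer condition at every finite
place NOT over such primes (Kolyvagin classes: Gross 6.2(1) at `2`; restricted auxiliary classes: Kummer by construction) `hres` follows
from the single hypothesis **(NPh_M)**: «a class of `H¹(K, E[2^M])` dying on `Γ_{K(E[2^M])}` and Selmer at every finite place is zero».
* `mem_torsionLocalKer_of_forall_h1Eval_eq_zero_of_isKolyvaginPrime_pow` — Φ-KILL at level `2^M`, index `≥ M`;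
* `eq_zero_of_phantom_of_selmer_outside_pow` — (NPh_M) ⟹ a phantom class Selmer off deep places is zero;
* **`hres_of_nonPhantom_pow`** — (NPh_M) ⟹ Q5R's `hres` for a finite family `cs : Fin r → H¹(K, E[2^M])` Selmer off deep places.
Namespace `…Theorems.GenusExact.RelaxedCount`.  Closes nothing.  BSD is NOT proved by any of this.

References: [McCallumLMS1991] §3 Cor. 3.2 (hypothesis (3)); [GrossLMS1991] §9 Prop. 9.6; [LawsonWuthrich2016] Lemma 6, §7.1.
-/

set_option autoImplicit false
-- the Theorems namespace of this sub repeats the summit name by design (D-0017 nested layout)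
set_option linter.dupNamespace false

noncomputable section

open scoped Classical

open Field NumberField IsDedekindDomain WeierstrassCurve
open Literature.NumberTheory.EllipticCurves
open Literature.NumberTheory.GaloisRepresentations
open Summit.BirchSwinnertonDyer.Rank1Residual.JET.GlobalDuality (galoisRep_toLocal_apply_eq_self)

namespace Summit.BirchSwinnertonDyer.BirchSwinnertonDyer.Theorems.GenusExact.RelaxedCount

variable (W : WeierstrassCurve ℚ) [W.IsElliptic] [W.IsGloballyMinimal] {K : Type} [Field K] [NumberField K]

/-- **Φ-KILL at level `2^M`.** `K` imaginary quadratic, `ℓ` a Zhang–Kolyvagin prime at `2` of index `≥ M`, `w ∋ ℓ`.  A class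
`z ∈ H¹(K, E[2^M])` with `[z, ρ] = 0` for all `ρ ∈ Γ_{K(E[2^M])}` is locally zero at `w` (`Γ_{K_w}` fixes `E[2^M]`).
[cite: McCallumLMS1991, §3 (3) and Prop. 4.4 (proof)] [cite: LawsonWuthrich2016, Lemma 6] -/
theorem mem_torsionLocalKer_of_forall_h1Eval_eq_zero_of_isKolyvaginPrime_pow (hK : IsImaginaryQuadratic K) {M ℓ : ℕ}
    (hℓ : Zhang2014.IsKolyvaginPrime (W.conductorNorm ℤ) W K 2 ℓ) (hM : M ≤ Zhang2014.kolyvaginIndex W 2 ℓ)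
    (w : HeightOneSpectrum (𝓞 K)) (hw : (ℓ : 𝓞 K) ∈ w.asIdeal) {z : galH1Torsion (W.baseChange K) ((2 ^ M : ℕ) : ℤ)}
    (hz : ∀ ρ ∈ torsionFixing (W.baseChange K) ((2 ^ M : ℕ) : ℤ), h1Eval (W.baseChange K) ((2 ^ M : ℕ) : ℤ) z ρ = 0) :
    z ∈ (W.baseChange K).torsionLocalKer (w.adicCompletion K) ((2 ^ M : ℕ) : ℤ) := by
  haveI : Fact (Nat.Prime 2) := ⟨Nat.prime_two⟩
  refine mem_torsionLocalKer_of_forall_h1Eval_eq_zero (W.baseChange K) _ w hz fun g ↦ ?_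
  rw [mem_torsionFixing_iff]
  intro P
  exact galoisRep_toLocal_apply_eq_self W K hK hℓ hM w hw g P

/-- **(NPh_M) ⟹ a phantom class Selmer off deep places is zero.**  `T` a finite set of places of `ℚ` each under a Zhang–Kolyvagin
prime of index `≥ M`; (NPh_M); `z` dying on `Γ_{K(E[2^M])}` and Selmer at every finite place of `K` not over `T` ⟹ `z = 0`.
[cite: McCallumLMS1991, §3 Cor. 3.2 (hypothesis (3))] [cite: GrossLMS1991, §9 Prop. 9.6] -/
theorem eq_zero_of_phantom_of_selmer_outside_pow (hK : IsImaginaryQuadratic K) {M : ℕ} (T : Finset (Place ℚ))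
    (hT : ∀ u ∈ T, ∃ (v : HeightOneSpectrum (𝓞 ℚ)) (ℓ : ℕ), u = Sum.inr v ∧ ℓ.Prime ∧ (ℓ : 𝓞 ℚ) ∈ v.asIdeal ∧
      Zhang2014.IsKolyvaginPrime (W.conductorNorm ℤ) W K 2 ℓ ∧ M ≤ Zhang2014.kolyvaginIndex W 2 ℓ)
    (hNPh : ∀ z : galH1Torsion (W.baseChange K) ((2 ^ M : ℕ) : ℤ),
      (∀ ρ ∈ torsionFixing (W.baseChange K) ((2 ^ M : ℕ) : ℤ), h1Eval (W.baseChange K) ((2 ^ M : ℕ) : ℤ) z ρ = 0) →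
      (∀ w : HeightOneSpectrum (𝓞 K), z ∈ selmerLocalKer (W.baseChange K) (w.adicCompletion K) ((2 ^ M : ℕ) : ℤ)) → z = 0)
    {z : galH1Torsion (W.baseChange K) ((2 ^ M : ℕ) : ℤ)}
    (hz : ∀ ρ ∈ torsionFixing (W.baseChange K) ((2 ^ M : ℕ) : ℤ), h1Eval (W.baseChange K) ((2 ^ M : ℕ) : ℤ) z ρ = 0)
    (hzK : ∀ w : HeightOneSpectrum (𝓞 K), (Sum.inr (w.under (𝓞 ℚ)) : Place ℚ) ∉ T →
      z ∈ selmerLocalKer (W.baseChange K) (w.adicCompletion K) ((2 ^ M : ℕ) : ℤ)) :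
    z = 0 := by
  refine hNPh z hz fun w ↦ ?_
  by_cases hw : (Sum.inr (w.under (𝓞 ℚ)) : Place ℚ) ∈ T
  · obtain ⟨v, ℓ, huv, hℓp, hℓv, hKol, hidx⟩ := hT _ hw
    have hvw : w.under (𝓞 ℚ) = v := Sum.inr_injective huv
    haveI : w.asIdeal.LiesOver v.asIdeal := ⟨by rw [← hvw]; rfl⟩
    have hℓw : (ℓ : 𝓞 K) ∈ w.asIdeal := by
      have h : algebraMap (𝓞 ℚ) (𝓞 K) (ℓ : 𝓞 ℚ) ∈ w.asIdeal := by
        rw [← Ideal.mem_comap, ← Ideal.under_def, ← Ideal.LiesOver.over (P := w.asIdeal) (p := v.asIdeal)]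
        exact hℓv
      rwa [map_natCast] at h
    exact (W.baseChange K).torsionLocalKer_le_selmerLocalKer (w.adicCompletion K) _
      (mem_torsionLocalKer_of_forall_h1Eval_eq_zero_of_isKolyvaginPrime_pow W hK hKol hidx w hℓw hz)
  · exact hzK w hw

/-- **(NPh_M) ⟹ Q5R's separation hypothesis `hres`** for a finite family `cs : Fin r → H¹(K, E[2^M])` each Selmer at every finite
place of `K` not over `T` (a finite set of places of `ℚ` under Zhang–Kolyvagin primes of index `≥ M`): every `ℤ`-combination dying on
`Γ_{K(E[2^M])}` vanishes.  This is the `hres` binder of `EquivariantChebotarevAtTwoR` / `…_eigen_of_not_isSquare` /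
`PlusDescent.infinite_kolyvaginPrime_localization_fullOrder_pair` for Kolyvagin classes `c_M(m)` (`m ∣ ∏ T`, Selmer off `m`) and
restricted auxiliary classes. [cite: McCallumLMS1991, §3 Cor. 3.2 (hypothesis (3))] -/
theorem hres_of_nonPhantom_pow (hK : IsImaginaryQuadratic K) {M : ℕ} (T : Finset (Place ℚ))
    (hT : ∀ u ∈ T, ∃ (v : HeightOneSpectrum (𝓞 ℚ)) (ℓ : ℕ), u = Sum.inr v ∧ ℓ.Prime ∧ (ℓ : 𝓞 ℚ) ∈ v.asIdeal ∧
      Zhang2014.IsKolyvaginPrime (W.conductorNorm ℤ) W K 2 ℓ ∧ M ≤ Zhang2014.kolyvaginIndex W 2 ℓ)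
    (hNPh : ∀ z : galH1Torsion (W.baseChange K) ((2 ^ M : ℕ) : ℤ),
      (∀ ρ ∈ torsionFixing (W.baseChange K) ((2 ^ M : ℕ) : ℤ), h1Eval (W.baseChange K) ((2 ^ M : ℕ) : ℤ) z ρ = 0) →
      (∀ w : HeightOneSpectrum (𝓞 K), z ∈ selmerLocalKer (W.baseChange K) (w.adicCompletion K) ((2 ^ M : ℕ) : ℤ)) → z = 0)
    {r : ℕ} (cs : Fin r → galH1Torsion (W.baseChange K) ((2 ^ M : ℕ) : ℤ))
    (hcs : ∀ i, ∀ w : HeightOneSpectrum (𝓞 K), (Sum.inr (w.under (𝓞 ℚ)) : Place ℚ) ∉ T →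
      cs i ∈ selmerLocalKer (W.baseChange K) (w.adicCompletion K) ((2 ^ M : ℕ) : ℤ)) :
    ∀ a : Fin r → ℤ, (∀ ρ ∈ torsionFixing (W.baseChange K) ((2 ^ M : ℕ) : ℤ),
      h1Eval (W.baseChange K) ((2 ^ M : ℕ) : ℤ) (∑ i, a i • cs i) ρ = 0) → ∑ i, a i • cs i = 0 := by
  intro a ha
  refine eq_zero_of_phantom_of_selmer_outside_pow W hK T hT hNPh ha fun w hw ↦ ?_
  exact AddSubgroup.sum_mem _ fun i _ ↦ AddSubgroup.zsmul_mem _ (hcs i w hw) (a i)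

end Summit.BirchSwinnertonDyer.BirchSwinnertonDyer.Theorems.GenusExact.RelaxedCount

end
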